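import Summits.QuantumFields.YangMills.Theorems.BalabanUVNodesK2CornerRoadRows
import Summits.QuantumFields.YangMills.Theorems.BalabanUVNodesN18CornerBandOfKernelLetters

/-!
# Route `BalabanUVNodes` rev 27 — THE MASS-BAND CORNER ROAD TO THE ROWS (CRIT-2 g3's located repair R-BM in kernel form; hypothesis form; 0 `def`, 0 `sorry`):
# the history moduli `HistLipschitz Λ θ.γ D.βfun` WITH BOUNDED MASS `Σ_{i≤k} |Λ k i| ≤ M` and a per-scale anchor ALONE manufacture the constant remainder at every height —
# NO N17 rate `ScaleShiftRate`, NO `FadingMemory` — so «U3ᴷ-lite + v7c's 2ᶜᴰ» pays DEF-1's rows, `RowsContAll`, and K1⁸ `StabilityBRunRowsAtRecordR13SepCoPH` BY NAME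

Cell `ym-nodeO-ideate`, PROVER seat `ym-nodeO-port-1` (gen 3).  Sixth file of the corner road; sibling of `…K2CornerRoadRows` (p620216, this seat).  Helper keyed
`--supports stmt-QuantumFields-26907 --as helper` (K1⁸, crux r3 DECIDING since rev 27 `12afebc05bbc`); count-neutral; NO skeleton is registered or re-keyed by this file.
WHY (CRIT-2 g3, HOME STATUS S.2003, E-CRIT2-2 + R-BM, 2026-08-28T09:20Z).  At the current record, modulo the cell's finding H_FE′, the GEOMETRIC letters of K3⁷'s U3 triple — N17's
`ScaleShiftRate c ρ θ.γ D.βfun` and `FadingMemory C ρ Λ` — are presumptively uninhabited, so the corner→rows road of p620216 §1–§4 (lever: p599976 `constRemainder_of_scaleShiftRate_scaleAnchor`,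
N17 + anchor by telescoping) is a harmless theorem but a dead supplier road until F-E is repaired.  CRIT-2's located repair R-BM: the ROWS need no convergence of the corner numbers, hence no
rate — re-type the letter pair as U3ᴷ-lite := «`HistLipschitz Λ θ.γ D.βfun` ∧ `∃ M, ∀ k, Σ_{i≤k} |Λ k i| ≤ M`» (bounded moduli mass; F-E-robust, and implied post-repair by `FadingMemory` via
dag-n18-w1's `sum_abs_moduli_le_of_fadingMemory`).  THIS FILE types that road: dag-n18-w1's band lemmas (`YMDAG.N18.CornerBandOfKernelLetters.abs_sub_le_sum_of_anchor_of_histLipschitz` — the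
anchor radius is immaterial, the moduli carry `|β_k(p) − b_k| ≤ Σ_i |Λ k i|·p_i` out to the window — and `abs_sub_le_mul_of_band`) give DEF-1's `ConstRemainder β b s γ_s` at EVERY height
`s > 0` on the level `γ_s := min γ (s∕(M+1))`; the rest is p620216's bookkeeping VERBATIM with this lever in place of N17's (floor from the drift, (C) from the moduli, any-slack ∕ ceiling-keyed
worlds).  ATTRIBUTION: CRIT-2 g3 (the repair), dag-n18-w1 (the band lemmas, used BY NAME), DEF-1 ∕ dag-n24-w1 ∕ plan g84 as in p620216; nothing of theirs restated.

CONTENTS.  §1 generic `constRemainder_of_histLipschitz_massBound_scaleAnchor` · per tuple ★ `runRowsCont13_of_moduliMass_scaleAnchor_drift` (U3ᴷ-lite letters + `ScaleAnchor D.βfun b` +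
`OneLoopDrift s A b`, `0 < s` ⟹ `RunRowsCont13 F θ`).  §2 K-keyed (crux keying, `Window13`; 2ᶜᴰ-text VERBATIM as in p613914 ∕ p620216; U3ᴷ-lite text := prefix →
`∃ (Λ : ℕ → ℕ → ℝ) (M : ℝ), HistLipschitz Λ θ.γ D.βfun ∧ ∀ k, Σ_{i : Fin (k+1)} |Λ k i| ≤ M`): `u3LiteK_of_u3K` (U3ᴷ ⟹ U3ᴷ-lite: the lite road SUBSUMES p620216 §2) ·
★★ `rowsContAll_of_u3LiteK_cornerDriftPosK` · ★ `stabilityBRunRowsAtRecordR13SepCoPH_of_k17_u3LiteK_cornerDriftPosK` (aside K1⁷ + U3ᴷ-lite + 2ᶜᴰ ⟹ K1⁸ BY NAME).  §3 at a K1 witness: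
★ `runRowsContAtSomeRecord13PWS_of_rung1At_moduliMass_cornerDrift_lt` (any slack `s + 2A < w.βup`) · `runRowsContAtSomeRecord13PWS_of_ceilingKeyedRung1_moduliMass_cornerDrift` (match-free,
dag-n24-w1's ceiling-keyed family of p620073) · ★★ `stabilityBRunRowsAtRecordR13SepCoPH_of_ceilingKeyedRung1WithMassBandCornerLetters` (K1⁸ BY NAME — N17-free, match-free).

HONEST FRAMING.  Implications between displayed HYPOTHESIS SHAPES and elementary real bookkeeping; NOTHING of Bałaban's analysis is asserted or discharged; whether U3ᴷ-lite, the anchor or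
the drift are inhabited at the record is the U3 ∕ N18 ∕ F-E ∕ (D1) desks' question, NOT claimed (instance 0∕1); no stub proved; K0⁷ ∕ K1⁸ ∕ K3⁷ OPEN; counts unmoved (typed 28∕28 · discharged
5∕27 (A 5∕28)); [Balaban1987RG1] Thm 2 + (0.31) p. 259 and §1's continuity are UNPROVED IN PRINT; route R4 closes the CONDITIONAL finite-𝕋⁴ rung `BalabanLadder.UV` only — NOT the continuum
limit, NOT ℝ⁴, NOT OS, NOT the Yang–Mills mass gap, NOT Clay.  No `def`, no `instance`, no `notation`, no `axiom`.  Sources (context only): [I] = [Balaban1987RG1] CMP **109** (1987): Thm 2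
p. 259 (first sentence), §1 pp. 263–264, Thm 3 p. 264, (1.20)–(1.22) p. 264, (2.12)–(2.14) p. 268, (5.10) p. 293, §5 p. 298; [II] = [Balaban1988RG2Cluster] CMP **116** (1988): Lemma 3 (2.38)
p. 20, (2.41) p. 21; [III] = [Balaban1988Convergent] CMP **119** (1988): Thm 1 p. 262; [V] = [Balaban1989LargeFieldII] CMP **122** (1989): Thm 1 p. 355.
-/

noncomputable section

open scoped Matrix.Norms.L2Operator

namespace Summit.QuantumFields.YangMills.Theorems.BalabanUVNodesK2CornerRoadRowsMassBand

open Literature.MathematicalPhysics.QuantumFieldTheory.Balaban1983to89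
open Literature.MathematicalPhysics.QuantumFieldTheory.Balaban1983to89.FlowStep
open Literature.MathematicalPhysics.QuantumFieldTheory.Balaban1983to89.FlowStepRuns
open Literature.MathematicalPhysics.QuantumFieldTheory.Balaban1983to89.DagBinding
open Literature.MathematicalPhysics.QuantumFieldTheory.Balaban1983to89.T4Continuum (T4Family)
open Literature.MathematicalPhysics.QuantumFieldTheory.Balaban1983to89.T4CouplingMatching (ScaleShiftRate HistLipschitz FadingMemory)
open Literature.MathematicalPhysics.QuantumFieldTheory.Balaban1983to89.Beta.Drift (OneLoopDrift)
open Summit.QuantumFields.YangMills.Theorems.BalabanUVNodesK2NamedJetsRemAt (ScaleAnchor ConstRemainder band_of_drift)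
open Summit.QuantumFields.YangMills.Theorems.BalabanUVNodesK2NamedJetsRunRemAt
  (RunConstRemainder SurvCont runwisePS_of_drift_runConstRemainder runConstRemainder_of_constRemainder)
open Summit.QuantumFields.YangMills.Theorems.BalabanUVNodesK2V6Defs (Window13)
open Summit.QuantumFields.YangMills.Theorems.K1V6Defs (RecordS Inhabited13)
open Summit.QuantumFields.YangMills.Theorems.BalabanUVNodesK1R8RowsDefs
  (RunRowsCont13 RowsContAll runRowsCont13_intro stabilityBRunRowsAtRecordR13SepCoPH_of_k17_rowsContAll)
open Summit.QuantumFields.YangMills.Theorems.K1V7RDefs (RunRowsContAtSomeRecord13PWS stabilityBRunRowsAtRecordR13SepCoPH_of_rung0_runRowsCont)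
open Summit.QuantumFields.YangMills.Theses.BalabanUVNodes (StabilityBAtRecordR13SepCoPH StabilityBRunRowsAtRecordR13SepCoPH)
open YMDAG.N18.CornerBandOfKernelLetters (abs_sub_le_sum_of_anchor_of_histLipschitz abs_sub_le_mul_of_band sum_abs_moduli_le_of_fadingMemory)

/-! ## §1 The lever: moduli with bounded mass + a per-scale anchor ⟹ DEF-1's constant remainder at EVERY height (no N17); per tuple, the rows -/

section Generic

variable {β : HBeta} {b : ℕ → ℝ} {Λ : ℕ → ℕ → ℝ} {γ M : ℝ}

/-- **★ THE MASS-BAND LEVER (R-BM)**: history moduli `HistLipschitz Λ γ β` (`0 < γ`) with BOUNDED MASS `Σ_{i : Fin (k+1)} |Λ k i| ≤ M` at every scale and a per-scale anchor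
`ScaleAnchor β b` ⟹ for every height `s > 0` DEF-1's `ConstRemainder β b s γ_s` on the level `γ_s := min γ (s∕(M+1))` (`0 < γ_s ≤ γ`): dag-n18-w1's linear band
`|β_k(p) − b_k| ≤ Σ_i |Λ k i|·p_i` on the whole window (`abs_sub_le_sum_of_anchor_of_histLipschitz` — the anchor radius is immaterial) restricted to `]0, γ_s]^{k+1}` (`abs_sub_le_mul_of_band`),
then `M·γ_s ≤ s`.  No rate, no telescoping, no convergence of `b`.  CONDITIONAL; instance 0∕1. [cite: Balaban1987RG1, (2.12)-(2.14) p.268 and §5 p.298] -/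
theorem constRemainder_of_histLipschitz_massBound_scaleAnchor (hγ : 0 < γ) (hL : HistLipschitz Λ γ β) (hM : ∀ k, ∑ i : Fin (k + 1), |Λ k i| ≤ M) (hb : ScaleAnchor β b)
    {s : ℝ} (hs : 0 < s) : ∃ γs : ℝ, 0 < γs ∧ γs ≤ γ ∧ ConstRemainder β b s γs := by
  have h0 : (0 : ℝ) ≤ ∑ i : Fin (0 + 1), |Λ 0 i| := Finset.sum_nonneg fun i _ => abs_nonneg _
  have hM0 : 0 ≤ M := h0.trans (hM 0)
  have hband : ∀ (k : ℕ) (p : Fin (k + 1) → ℝ), p ∈ Box γ k → |β k p - b k| ≤ ∑ i : Fin (k + 1), |Λ k i| * p i :=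
    fun k p hp => abs_sub_le_sum_of_anchor_of_histLipschitz hL hb k hp
  refine ⟨min γ (s / (M + 1)), lt_min hγ (by positivity), min_le_left _ _, fun k p hp => ?_⟩
  have h1 : |β k p - b k| ≤ (∑ i : Fin (k + 1), |Λ k i|) * min γ (s / (M + 1)) := abs_sub_le_mul_of_band hband (min_le_left _ _) k hp
  have hmin0 : 0 ≤ min γ (s / (M + 1)) := (lt_min hγ (by positivity)).le
  have h2 : (∑ i : Fin (k + 1), |Λ k i|) * min γ (s / (M + 1)) ≤ M * (s / (M + 1)) :=
    (mul_le_mul_of_nonneg_right (hM k) hmin0).trans (mul_le_mul_of_nonneg_left (min_le_right _ _) hM0)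
  have h3 : M * (s / (M + 1)) ≤ s := by
    rw [mul_div_assoc']
    exact (div_le_iff₀ (by positivity)).mpr (by nlinarith)
  exact h1.trans (h2.trans h3)

end Generic

section AtTuple

variable (F : T4Family) (θ : Node00.Stage13HParams F 2) (hP : θ.Provisos₁₃SepCoPH F 2)

/-- **★ THE MASS-BAND CORNER ROAD IN THE ROWS CURRENCY, per tuple** (U3ᴷ-lite; N17-free): history moduli `HistLipschitz Λ θ.γ D.βfun` (`0 < θ.γ`) with bounded mass
`Σ_i |Λ k i| ≤ M`, a per-scale anchor `ScaleAnchor D.βfun b` and a drift `OneLoopDrift s A b` with `0 < s` ⟹ DEF-1's rows `RunRowsCont13 F θ` — constant remainder at the height `s`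
itself on the level `γ_s` (§1 ★) restricted to the in-window runs, floor `−2A` from the drift (cap `le_rfl`), (C) on the survivor sets of level `γ_s` from the moduli
(`betaContH_of_histLipschitz`, `SurvCont.of_betaContH`).  CONDITIONAL on four hypothesis shapes; instance 0∕1; nothing of Bałaban asserted.
[cite: Balaban1987RG1, Thm 3 p.264, (2.12)-(2.14) p.268, (5.10) p.293, §1 pp.263-264 and §5 p.298; Balaban1988RG2Cluster, Lemma 3 (2.38) p.20] -/
theorem runRowsCont13_of_moduliMass_scaleAnchor_drift (hγ : 0 < θ.γ) {Λ : ℕ → ℕ → ℝ} {M : ℝ}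
    (hL : HistLipschitz Λ θ.γ (Node00.datumOfRecord₁₃SepCoPH F 2 θ hP).βfun) (hM : ∀ k, ∑ i : Fin (k + 1), |Λ k i| ≤ M)
    {b : ℕ → ℝ} {s A : ℝ} (hb : ScaleAnchor (Node00.datumOfRecord₁₃SepCoPH F 2 θ hP).βfun b) (hs : 0 < s) (hdrift : OneLoopDrift s A b) : RunRowsCont13 F θ := by
  obtain ⟨γs, hγs, hle, hrem⟩ := constRemainder_of_histLipschitz_massBound_scaleAnchor hγ hL hM hb hs
  have hrun := runConstRemainder_of_constRemainder hrem
  exact runRowsCont13_intro θ hγs hrun (runwisePS_of_drift_runConstRemainder hdrift hrun le_rfl)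
    (SurvCont.of_betaContH hγs fun k => (T4BetaStationary.betaContH_of_histLipschitz hL k).mono (box_mono hle k))

end AtTuple

/-! ## §2 K-keyed: U3ᴷ ⟹ U3ᴷ-lite; U3ᴷ-lite + v7c's registered 2ᶜᴰ text pay `RowsContAll`, hence (with the aside K1⁷) K1⁸ BY NAME -/

section Texts

/-- **U3ᴷ ⟹ U3ᴷ-lite**: K3⁷'s shared triple (N17 rate, moduli, `FadingMemory C ρ Λ` with `0 < ρ < 1`) gives the lite letter (moduli with bounded mass `M := C(1−ρ)⁻¹`,
dag-n18-w1's `sum_abs_moduli_le_of_fadingMemory`); so every concluder below SUBSUMES its U3ᴷ twin in p620216 §2.  Texts at the crux keying, `Window13`. [cite: Balaban1987RG1, (2.12)-(2.14) p.268 and §5 p.298] -/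
theorem u3LiteK_of_u3K
    (hU3 : ∀ (F : T4Family) (θ : Node00.Stage13HParams F 2) (hP : θ.Provisos₁₃SepCoPH F 2), (θ.ZhUnity F 2 ∧ θ.SlotsNondegenerate₁₃ F 2) → θ.Admissible F 2 →
      B16.EndStatementBPrinted (Node00.datumOfRecord₁₃SepCoPH F 2 θ hP).C → Window13 F θ hP →
      ∃ (c C ρ : ℝ) (Λ : ℕ → ℕ → ℝ), 0 ≤ c ∧ 0 < ρ ∧ ρ < 1 ∧ ScaleShiftRate c ρ θ.γ (Node00.datumOfRecord₁₃SepCoPH F 2 θ hP).βfun ∧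
        HistLipschitz Λ θ.γ (Node00.datumOfRecord₁₃SepCoPH F 2 θ hP).βfun ∧ T4CouplingMatching.FadingMemory C ρ Λ) :
    ∀ (F : T4Family) (θ : Node00.Stage13HParams F 2) (hP : θ.Provisos₁₃SepCoPH F 2), (θ.ZhUnity F 2 ∧ θ.SlotsNondegenerate₁₃ F 2) → θ.Admissible F 2 →
      B16.EndStatementBPrinted (Node00.datumOfRecord₁₃SepCoPH F 2 θ hP).C → Window13 F θ hP →
      ∃ (Λ : ℕ → ℕ → ℝ) (M : ℝ), HistLipschitz Λ θ.γ (Node00.datumOfRecord₁₃SepCoPH F 2 θ hP).βfun ∧ ∀ k, ∑ i : Fin (k + 1), |Λ k i| ≤ M :=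
  fun F θ hP hU hθ hB hwin => by
  obtain ⟨-, C, ρ, Λ, -, hρ0, hρ1, -, hL, hF⟩ := hU3 F θ hP hU hθ hB hwin
  exact ⟨Λ, C * (1 - ρ)⁻¹, hL, fun k => sum_abs_moduli_le_of_fadingMemory hF hρ0.le hρ1 k⟩

/-- **★★ U3ᴷ-lite + v7c's REGISTERED JOINT STUB 2ᶜᴰ PAY THE ∀θ ROWS PROGRAMME `RowsContAll`** (R-BM's road; 2ᶜᴰ-text VERBATIM as in p613914): per tuple §1's ★ — N17-free,
`FadingMemory`-free, no (190)-chain stub.  With DEF-1's bridges this gives the aside K2⁷ (`endpointGivenBR13SepCoPH_of_rowsContAll`) and, with K1⁷, K1⁸ (next theorem).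
CONDITIONAL on two hypothesis shapes; instance 0∕1; nothing of Bałaban asserted. [cite: Balaban1987RG1, Thm 3 p.264, (2.12)-(2.14) p.268, (5.10) p.293, §1 pp.263-264 and §5 p.298] -/
theorem rowsContAll_of_u3LiteK_cornerDriftPosK
    (hLite : ∀ (F : T4Family) (θ : Node00.Stage13HParams F 2) (hP : θ.Provisos₁₃SepCoPH F 2), (θ.ZhUnity F 2 ∧ θ.SlotsNondegenerate₁₃ F 2) → θ.Admissible F 2 →
      B16.EndStatementBPrinted (Node00.datumOfRecord₁₃SepCoPH F 2 θ hP).C → Window13 F θ hP →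
      ∃ (Λ : ℕ → ℕ → ℝ) (M : ℝ), HistLipschitz Λ θ.γ (Node00.datumOfRecord₁₃SepCoPH F 2 θ hP).βfun ∧ ∀ k, ∑ i : Fin (k + 1), |Λ k i| ≤ M)
    (hCD : ∀ (F : T4Family) (θ : Node00.Stage13HParams F 2) (hP : θ.Provisos₁₃SepCoPH F 2), (θ.ZhUnity F 2 ∧ θ.SlotsNondegenerate₁₃ F 2) → θ.Admissible F 2 →
      B16.EndStatementBPrinted (Node00.datumOfRecord₁₃SepCoPH F 2 θ hP).C → Window13 F θ hP →
      ∃ (b : ℕ → ℝ) (s A : ℝ), ScaleAnchor (Node00.datumOfRecord₁₃SepCoPH F 2 θ hP).βfun b ∧ 0 < s ∧ OneLoopDrift s A b) : RowsContAll := by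
  intro F θ hP hU hθ hB hwin
  obtain ⟨Λ, M, hL, hM⟩ := hLite F θ hP hU hθ hB hwin
  obtain ⟨b, s, A, hb, hs, hdrift⟩ := hCD F θ hP hU hθ hB hwin
  exact runRowsCont13_of_moduliMass_scaleAnchor_drift F θ hP hθ.toStage12.toStage9.gamma_pos hL hM hb hs hdrift

/-- **★ THE ASIDE K1⁷ + U3ᴷ-lite + 2ᶜᴰ ⟹ THE DECIDING CRUX K1⁸ `…Theses.BalabanUVNodes.StabilityBRunRowsAtRecordR13SepCoPH` (stmt-QuantumFields-26907) BY NAME** (DEF-1's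
`stabilityBRunRowsAtRecordR13SepCoPH_of_k17_rowsContAll`).  CONDITIONAL on three displayed texts (none supplied here); K1⁸ NOT closed; nothing of Bałaban asserted; no count moved.
[cite: Balaban1989LargeFieldII, Thm 1 p.355; Balaban1987RG1, Thm 3 p.264, (2.12)-(2.14) p.268, (5.10) p.293 and §1 pp.263-264] -/
theorem stabilityBRunRowsAtRecordR13SepCoPH_of_k17_u3LiteK_cornerDriftPosK (h1 : StabilityBAtRecordR13SepCoPH)
    (hLite : ∀ (F : T4Family) (θ : Node00.Stage13HParams F 2) (hP : θ.Provisos₁₃SepCoPH F 2), (θ.ZhUnity F 2 ∧ θ.SlotsNondegenerate₁₃ F 2) → θ.Admissible F 2 →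
      B16.EndStatementBPrinted (Node00.datumOfRecord₁₃SepCoPH F 2 θ hP).C → Window13 F θ hP →
      ∃ (Λ : ℕ → ℕ → ℝ) (M : ℝ), HistLipschitz Λ θ.γ (Node00.datumOfRecord₁₃SepCoPH F 2 θ hP).βfun ∧ ∀ k, ∑ i : Fin (k + 1), |Λ k i| ≤ M)
    (hCD : ∀ (F : T4Family) (θ : Node00.Stage13HParams F 2) (hP : θ.Provisos₁₃SepCoPH F 2), (θ.ZhUnity F 2 ∧ θ.SlotsNondegenerate₁₃ F 2) → θ.Admissible F 2 →
      B16.EndStatementBPrinted (Node00.datumOfRecord₁₃SepCoPH F 2 θ hP).C → Window13 F θ hP →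
      ∃ (b : ℕ → ℝ) (s A : ℝ), ScaleAnchor (Node00.datumOfRecord₁₃SepCoPH F 2 θ hP).βfun b ∧ 0 < s ∧ OneLoopDrift s A b) :
    StabilityBRunRowsAtRecordR13SepCoPH :=
  stabilityBRunRowsAtRecordR13SepCoPH_of_k17_rowsContAll h1 (rowsContAll_of_u3LiteK_cornerDriftPosK hLite hCD)

end Texts

/-! ## §3 At a K1 witness: the mass-band producers (any slack ∕ ceiling-keyed) and K1⁸ BY NAME — N17-free, match-free -/

section Witness

variable {F : T4Family}

/-- **★ ANY SLACK (U3ᴷ-lite)**: rung-1 data `(θ, h, w)` (unity ∧ slots, admissibility, `RecordS F θ h w`, the thirteen nodes at every run) + moduli with bounded mass + a per-scale anchor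
`ScaleAnchor D.βfun b` + a drift `OneLoopDrift s A b` (`0 < s`) + the OPEN match `s + 2A < w.βup` ⟹ rung 2‴ `RunRowsContAtSomeRecord13PWS F` — band `b_k ≤ s + 2A` (`band_of_drift`),
radius `min s (w.βup − (s + 2A))` by §1 ★, floor by the drift (cap `min_le_left`), (C) from the moduli.  CONDITIONAL; closes nothing.
[cite: Balaban1987RG1, Thm 3 p.264, (2.12)-(2.14) p.268, (5.10) p.293, §1 pp.263-264 and §5 p.298; Balaban1988RG2Cluster, Lemma 3 (2.38) p.20] -/
theorem runRowsContAtSomeRecord13PWS_of_rung1At_moduliMass_cornerDrift_lt (θ : Node00.Stage13HParams F 2) (h : θ.Provisos₁₃SepCoPH F 2) (w : WorldP)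
    (hU : θ.ZhUnity F 2 ∧ θ.SlotsNondegenerate₁₃ F 2) (hθ : θ.Admissible F 2) (hR : RecordS F θ h w) (hnodes : ∀ P : B12.RunParams, Nodes (leavesP w P))
    {Λ : ℕ → ℕ → ℝ} {M : ℝ} (hL : HistLipschitz Λ θ.γ (Node00.datumOfRecord₁₃SepCoPH F 2 θ h).βfun) (hM : ∀ k, ∑ i : Fin (k + 1), |Λ k i| ≤ M)
    {b : ℕ → ℝ} {s A : ℝ} (hb : ScaleAnchor (Node00.datumOfRecord₁₃SepCoPH F 2 θ h).βfun b) (hs : 0 < s) (hdrift : OneLoopDrift s A b)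
    (hmatch : s + 2 * A < w.βup) : RunRowsContAtSomeRecord13PWS F := by
  have hγ : 0 < θ.γ := hθ.toStage12.toStage9.gamma_pos
  have hr : 0 < min s (w.βup - (s + 2 * A)) := lt_min hs (by linarith)
  obtain ⟨γr, hγr, hle, hrem⟩ := constRemainder_of_histLipschitz_massBound_scaleAnchor hγ hL hM hb hr
  have hrun := runConstRemainder_of_constRemainder hrem
  have hband : ∀ k, b k ≤ s + 2 * A := fun k => by
    have := (abs_le.mp (band_of_drift hdrift k)).2
    linarith
  have hmatch' : s + 2 * A + min s (w.βup - (s + 2 * A)) ≤ w.βup := by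
    have := min_le_right s (w.βup - (s + 2 * A))
    linarith
  exact ⟨θ, h, w, hU, hθ, hR, hnodes, b, _, γr, s + 2 * A, 2 * A, hγr, hrun, hband, hmatch',
    runwisePS_of_drift_runConstRemainder hdrift hrun (min_le_left _ _),
    SurvCont.of_betaContH hγr fun k => (T4BetaStationary.betaContH_of_histLipschitz hL k).mono (box_mono hle k)⟩

/-- **MATCH-FREE (U3ᴷ-lite, ceiling-keyed rung 1)**: dag-n24-w1's family `∀ c, ∃ w, c ≤ w.βup ∧ RecordS F θ h w ∧ ∀ P, Nodes (leavesP w P)` (p620073 VERBATIM) + moduli with bounded mass +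
anchor + positive drift ⟹ rung 2‴: request the world at `s + 2A + 1`, then ★ above.  No numeric letter.  CONDITIONAL; closes nothing.
[cite: Balaban1988Convergent, Thm 1 p.262; Balaban1987RG1, Thm 3 p.264, (2.12)-(2.14) p.268, (5.10) p.293, §1 pp.263-264 and §5 p.298] -/
theorem runRowsContAtSomeRecord13PWS_of_ceilingKeyedRung1_moduliMass_cornerDrift (θ : Node00.Stage13HParams F 2) (h : θ.Provisos₁₃SepCoPH F 2)
    (hU : θ.ZhUnity F 2 ∧ θ.SlotsNondegenerate₁₃ F 2) (hθ : θ.Admissible F 2)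
    (hfam : ∀ c : ℝ, ∃ w : WorldP, c ≤ w.βup ∧ RecordS F θ h w ∧ ∀ P : B12.RunParams, Nodes (leavesP w P))
    {Λ : ℕ → ℕ → ℝ} {M : ℝ} (hL : HistLipschitz Λ θ.γ (Node00.datumOfRecord₁₃SepCoPH F 2 θ h).βfun) (hM : ∀ k, ∑ i : Fin (k + 1), |Λ k i| ≤ M)
    {b : ℕ → ℝ} {s A : ℝ} (hb : ScaleAnchor (Node00.datumOfRecord₁₃SepCoPH F 2 θ h).βfun b) (hs : 0 < s) (hdrift : OneLoopDrift s A b) :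
    RunRowsContAtSomeRecord13PWS F := by
  obtain ⟨w, hc, hR, hnodes⟩ := hfam (s + 2 * A + 1)
  exact runRowsContAtSomeRecord13PWS_of_rung1At_moduliMass_cornerDrift_lt θ h w hU hθ hR hnodes hL hM hb hs hdrift (by linarith)

/-- **★★ K1⁸ stmt-QuantumFields-26907 BY NAME ON THE MASS-BAND ROAD — N17-FREE, MATCH-FREE (R-BM's producer)**: for every family with a unity Stage-13 tuple, SOME unity admissible
tuple `θ` with provisos carries a CEILING-KEYED family of S-bound worlds of its datum with the thirteen nodes (the rung-1 lanes' export), history moduli of its datum's β with BOUNDED MASS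
(U3ᴷ-lite: `HistLipschitz Λ θ.γ D.βfun`, `Σ_i |Λ k i| ≤ M`), and a per-scale anchor drifting with a POSITIVE slope ⟹ `…Theses.BalabanUVNodes.StabilityBRunRowsAtRecordR13SepCoPH`
(the TYPE is the route decl literally).  On this road NODE O owes K1⁸ AT THE K1 WITNESS exactly {the anchor, the drift's positive slope}; the letters read from K3⁷'s side are the
moduli and their mass only (alive in both F-E worlds per CRIT-2 R-BM).  CONDITIONAL on `hprod` (not supplied here); K1⁸ NOT closed by this theorem; nothing of Bałaban asserted; no count moved.
[cite: Balaban1989LargeFieldII, Thm 1 p.355 and (0.1) pp.355-356; Balaban1988Convergent, Thm 1 p.262 and (2.6) p.255; Balaban1987RG1, Thm 2 p.259 (first sentence), Thm 3 p.264, (2.12)-(2.14) p.268, (5.10) p.293, §1 pp.263-264 and §5 p.298] -/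
theorem stabilityBRunRowsAtRecordR13SepCoPH_of_ceilingKeyedRung1WithMassBandCornerLetters
    (hprod : ∀ F : T4Family, Inhabited13 F →
      ∃ (θ : Node00.Stage13HParams F 2) (h : θ.Provisos₁₃SepCoPH F 2), (θ.ZhUnity F 2 ∧ θ.SlotsNondegenerate₁₃ F 2) ∧ θ.Admissible F 2 ∧
        (∀ c : ℝ, ∃ w : WorldP, c ≤ w.βup ∧ RecordS F θ h w ∧ ∀ P : B12.RunParams, Nodes (leavesP w P)) ∧
        (∃ (Λ : ℕ → ℕ → ℝ) (M : ℝ), HistLipschitz Λ θ.γ (Node00.datumOfRecord₁₃SepCoPH F 2 θ h).βfun ∧ ∀ k, ∑ i : Fin (k + 1), |Λ k i| ≤ M) ∧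
        ∃ (b : ℕ → ℝ) (s A : ℝ), ScaleAnchor (Node00.datumOfRecord₁₃SepCoPH F 2 θ h).βfun b ∧ 0 < s ∧ OneLoopDrift s A b) :
    StabilityBRunRowsAtRecordR13SepCoPH :=
  stabilityBRunRowsAtRecordR13SepCoPH_of_rung0_runRowsCont fun F hinh => by
    obtain ⟨θ, hP, hU, hθ, hfam, ⟨Λ, M, hL, hM⟩, b, s, A, hb, hs, hdrift⟩ := hprod F hinh
    exact runRowsContAtSomeRecord13PWS_of_ceilingKeyedRung1_moduliMass_cornerDrift θ hP hU hθ hfam hL hM hb hs hdrift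

/-- **… and WITH A PINNED WORLD (any slack)**: the same ∃-side producer with ONE S-bound world `w` built above `s + 2A` in place of the ceiling-keyed family.  CONDITIONAL; K1⁸ NOT closed.
[cite: Balaban1989LargeFieldII, Thm 1 p.355 and (0.1) pp.355-356; Balaban1987RG1, Thm 2 p.259 (first sentence), Thm 3 p.264, (2.12)-(2.14) p.268, (5.10) p.293 and §1 pp.263-264] -/
theorem stabilityBRunRowsAtRecordR13SepCoPH_of_rung1WithMassBandCornerLetters
    (hprod : ∀ F : T4Family, Inhabited13 F →
      ∃ (θ : Node00.Stage13HParams F 2) (h : θ.Provisos₁₃SepCoPH F 2), (θ.ZhUnity F 2 ∧ θ.SlotsNondegenerate₁₃ F 2) ∧ θ.Admissible F 2 ∧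
        (∃ (Λ : ℕ → ℕ → ℝ) (M : ℝ), HistLipschitz Λ θ.γ (Node00.datumOfRecord₁₃SepCoPH F 2 θ h).βfun ∧ ∀ k, ∑ i : Fin (k + 1), |Λ k i| ≤ M) ∧
        ∃ (b : ℕ → ℝ) (s A : ℝ), ScaleAnchor (Node00.datumOfRecord₁₃SepCoPH F 2 θ h).βfun b ∧ 0 < s ∧ OneLoopDrift s A b ∧
          ∃ w : WorldP, s + 2 * A < w.βup ∧ RecordS F θ h w ∧ ∀ P : B12.RunParams, Nodes (leavesP w P)) :
    StabilityBRunRowsAtRecordR13SepCoPH :=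
  stabilityBRunRowsAtRecordR13SepCoPH_of_rung0_runRowsCont fun F hinh => by
    obtain ⟨θ, hP, hU, hθ, ⟨Λ, M, hL, hM⟩, b, s, A, hb, hs, hdrift, w, hmatch, hR, hnodes⟩ := hprod F hinh
    exact runRowsContAtSomeRecord13PWS_of_rung1At_moduliMass_cornerDrift_lt θ hP w hU hθ hR hnodes hL hM hb hs hdrift hmatch

end Witness

end Summit.QuantumFields.YangMills.Theorems.BalabanUVNodesK2CornerRoadRowsMassBand

end
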